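import Literature.AnabelianGeometry.SemiGraphs.CoveringEssSurjPrep

/-!
# Reassembling an object of `B(𝒢)_{/A}` from an object of `B(𝒢_A)` ([SemiAnbd] Def. 2.2 (i) — brick G7(a))

Mochizuki, *Semi-graphs of anabelioids*, Publ. RIMS **42** (2006) 221–322, §2 p. 23
[cite: MochizukiSemiAnbd2006, Def. 2.2(i) p.23].  Given `D ∈ B(𝒢_A)`, the candidate preimage under
`toCovering A : B(𝒢)_{/A} ⥤ B(𝒢_A)` is the object `X` of `B(𝒢)` with `X_v := ∐_{(v,P)} D_{(v,P)}`,
`X_e := ∐_{(e,Q)} D_{(e,Q)}` (the pieces read back on the component anabelioids through the models), glued by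
`ψ_b^X : b^* X_v ≅ X_e` — the coproduct, over the edges `(e, Q)` above `e`, of the gluing isomorphisms of `D`
(`isColimit_cofan_branch`: `b^* X_v` IS that coproduct) — together with its structure map to `A`
(`reassembled`, `reassembledHom`, `reassembledOver`).  That `toCovering A (reassembledOver D) ≅ D` is the sequel.
-/

namespace Literature.AnabelianGeometry.SemiGraphs

namespace SemiGraphOfAnabelioids

open CategoryTheory CategoryTheory.Limits CategoryTheory.PreGaloisCategory
open Literature.AnabelianGeometry.Anabelioids

universe w' w v₁ u₁ u

-- Mathlib's `Over.pullback` / `Over.star` simp lemmas (`pullback.lift_fst`, …) only fire under the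
-- pre-v4.2x defeq transparency behaviour, exactly as in `Mathlib/CategoryTheory/Comma/Over/Pullback.lean`.
set_option backward.isDefEq.respectTransparency false

namespace BObj

variable {𝒢 : SemiGraphOfAnabelioids.{v₁, u₁, u}} (A : 𝒢.BObj) (D : A.coveringGraph.BObj)

/-- `(𝒢_A)_{(e,Q)} ⥤ Over Q`: the inverse model equivalence. [cite: MochizukiSemiAnbd2006, Def. 2.2(i) p.23] -/
noncomputable def fromE (ec : A.fibreData.total.Edge) :
    A.EModel ec ⥤ Over ((A.eComp ec).1 : 𝒢.E (A.fibreData.proj.edgeMap ec)) :=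
  (Shrink.equivalence (Over ((A.eComp ec).1 : 𝒢.E (A.fibreData.proj.edgeMap ec)))).inverse

/-! ### The pieces of `D` on the component anabelioids -/

/-- The `(v, P)`-piece of `D`, read in `Over P`. [cite: MochizukiSemiAnbd2006, Def. 2.2(i) p.23] -/
noncomputable def pieceV (v : 𝒢.graph.Vertex) (c : Shrink.{u} (π₀Obj (A.S v))) :
    Over ((A.vComp ⟨v, c⟩).1 : 𝒢.V (A.fibreData.proj.vertexMap ⟨v, c⟩)) :=
  (A.fromV ⟨v, c⟩).obj (D.S ⟨v, c⟩)

/-- The `(e, Q)`-piece of `D`, read in `Over Q`. [cite: MochizukiSemiAnbd2006, Def. 2.2(i) p.23] -/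
noncomputable def pieceE (e : 𝒢.graph.Edge) (c' : Shrink.{u} (π₀Obj (A.T e))) :
    Over ((A.eComp ⟨e, c'⟩).1 : 𝒢.E (A.fibreData.proj.edgeMap ⟨e, c'⟩)) :=
  (A.fromE ⟨e, c'⟩).obj (D.T ⟨e, c'⟩)

/-- The underlying vertex pieces, as a family in `𝒢_v`. [cite: MochizukiSemiAnbd2006, Def. 2.2(i) p.23] -/
noncomputable def famV (v : 𝒢.graph.Vertex) : Shrink.{u} (π₀Obj (A.S v)) → 𝒢.V v :=
  fun c => (A.pieceV D v c).left

/-- The underlying edge pieces, as a family in `𝒢_e`. [cite: MochizukiSemiAnbd2006, Def. 2.2(i) p.23] -/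
noncomputable def famE (e : 𝒢.graph.Edge) : Shrink.{u} (π₀Obj (A.T e)) → 𝒢.E e :=
  fun c' => (A.pieceE D e c').left

/-- The structure maps `D_{(v,P)} → P` of the vertex pieces. [cite: MochizukiSemiAnbd2006, Def. 2.2(i) p.23] -/
noncomputable def famVHom (v : 𝒢.graph.Vertex) (c : Shrink.{u} (π₀Obj (A.S v))) :
    A.famV D v c ⟶ ((A.vComp ⟨v, c⟩).1 : 𝒢.V (A.fibreData.proj.vertexMap ⟨v, c⟩)) :=
  (A.pieceV D v c).hom

/-- **The gluing isomorphisms of `D`, read on the component anabelioids**: the gluing object of the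
`(v, σ_b Q)`-piece along the branch `(b, Q)` is the `(e, Q)`-piece (cancel the model equivalences in
`ψ^D_{(b,Q)}`). [cite: MochizukiSemiAnbd2006, Def. 2.2(i) p.23] -/
noncomputable def pieceGlueIso {b : 𝒢.graph.Branch} {v : 𝒢.graph.Vertex} (h : 𝒢.graph.abuts b = some v)
    (c' : Shrink.{u} (π₀Obj (A.T (𝒢.graph.edgeOf b)))) :
    (A.gluingAt ⟨b, c'⟩ ⟨v, A.fibreData.σ b v h c'⟩ (A.total_abuts_mk h c')).obj
        (Over.mk (A.famVHom D v (A.fibreData.σ b v h c'))) ≅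
      A.pieceE D (𝒢.graph.edgeOf b) c' :=
  ((Shrink.equivalence (Over ((A.brComp ⟨b, c'⟩).1 :
      𝒢.E (𝒢.graph.edgeOf (A.fibreData.proj.branchMap ⟨b, c'⟩))))).unitIso.app _) ≪≫
    (Shrink.equivalence (Over ((A.brComp ⟨b, c'⟩).1 :
      𝒢.E (𝒢.graph.edgeOf (A.fibreData.proj.branchMap ⟨b, c'⟩))))).inverse.mapIso
      (D.ψ ⟨b, c'⟩ ⟨v, A.fibreData.σ b v h c'⟩ (A.total_abuts_mk h c'))

/-! ### The reassembled object -/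

/-- `X_v := ∐_{(v,P)} D_{(v,P)}`. [cite: MochizukiSemiAnbd2006, Def. 2.2(i) p.23] -/
noncomputable def glueV (v : 𝒢.graph.Vertex) : 𝒢.V v := ∐ A.famV D v

/-- `X_e := ∐_{(e,Q)} D_{(e,Q)}`. [cite: MochizukiSemiAnbd2006, Def. 2.2(i) p.23] -/
noncomputable def glueE (e : 𝒢.graph.Edge) : 𝒢.E e := ∐ A.famE D e

/-- **`b^* X_v` is the coproduct of the edge pieces `D_{(e,Q)}`** over the edges of `𝔾_A` above `e ∋ b`,
the `(e, Q)`-piece included through `ψ^D` and the gluing object of the branch `(b, Q)`.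
[cite: MochizukiSemiAnbd2006, Def. 2.2(i) p.23] -/
theorem isColimit_cofan_glueV {b : 𝒢.graph.Branch} {v : 𝒢.graph.Vertex} (h : 𝒢.graph.abuts b = some v) :
    Nonempty (IsColimit (Cofan.mk (f := A.famE D (𝒢.graph.edgeOf b)) ((𝒢.pull b v h).pullback.obj (A.glueV D v))
      (fun c' => ((Over.forget _).mapIso (A.pieceGlueIso D h c')).inv ≫
        (pullback.fst _ _ :
          ((A.gluingAt ⟨b, c'⟩ ⟨v, A.fibreData.σ b v h c'⟩ (A.total_abuts_mk h c')).obj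
            (Over.mk (A.famVHom D v (A.fibreData.σ b v h c')))).left ⟶ _) ≫
          (𝒢.pull b v h).pullback.map (Sigma.ι (A.famV D v) (A.fibreData.σ b v h c'))))) := by
  obtain ⟨hb⟩ := A.isColimit_cofan_branch h (A.famV D v) (A.famVHom D v)
  exact cofan_isColimit_of_iso_summands (fun c' => ((Over.forget _).mapIso (A.pieceGlueIso D h c')).symm) _ hb

/-- **`ψ_b^X : b^* X_v ≅ X_e`** — the coproduct of the gluing isomorphisms of `D`.
[cite: MochizukiSemiAnbd2006, Def. 2.2(i) p.23] -/
noncomputable def glueψ {b : 𝒢.graph.Branch} {v : 𝒢.graph.Vertex} (h : 𝒢.graph.abuts b = some v) :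
    (𝒢.pull b v h).pullback.obj (A.glueV D v) ≅ A.glueE D (𝒢.graph.edgeOf b) :=
  (A.isColimit_cofan_glueV D h).some.coconePointUniqueUpToIso (coproductIsCoproduct (A.famE D (𝒢.graph.edgeOf b)))

/-- The edge piece enters `b^* X_v` and `ψ_b^X` maps it to its coproduct inclusion in `X_e`.
[cite: MochizukiSemiAnbd2006, Def. 2.2(i) p.23] -/
@[reassoc] theorem ι_glueψ_hom {b : 𝒢.graph.Branch} {v : 𝒢.graph.Vertex} (h : 𝒢.graph.abuts b = some v)
    (c' : Shrink.{u} (π₀Obj (A.T (𝒢.graph.edgeOf b)))) :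
    (((Over.forget _).mapIso (A.pieceGlueIso D h c')).inv ≫
        (pullback.fst _ _ :
          ((A.gluingAt ⟨b, c'⟩ ⟨v, A.fibreData.σ b v h c'⟩ (A.total_abuts_mk h c')).obj
            (Over.mk (A.famVHom D v (A.fibreData.σ b v h c')))).left ⟶ _) ≫
          (𝒢.pull b v h).pullback.map (Sigma.ι (A.famV D v) (A.fibreData.σ b v h c'))) ≫
      (A.glueψ D h).hom = Sigma.ι (A.famE D (𝒢.graph.edgeOf b)) c' :=
  (A.isColimit_cofan_glueV D h).some.comp_coconePointUniqueUpToIso_hom _ ⟨c'⟩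

/-- **The reassembled object `X ∈ B(𝒢)`** of `D ∈ B(𝒢_A)`. [cite: MochizukiSemiAnbd2006, Def. 2.2(i) p.23] -/
noncomputable def reassembled : 𝒢.BObj where
  S v := A.glueV D v
  T e := A.glueE D e
  ψ _ _ h := A.glueψ D h

/-- The gluing isomorphisms of the reassembled object are the `glueψ`.
[cite: MochizukiSemiAnbd2006, Def. 2.2(i) p.23] -/
theorem reassembled_ψ {b : 𝒢.graph.Branch} {v : 𝒢.graph.Vertex} (h : 𝒢.graph.abuts b = some v) :
    (A.reassembled D).ψ b v h = A.glueψ D h :=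
  rfl

/-- The structure map `X → A`: on `X_v = ∐ D_{(v,P)}` it is `∐ (D_{(v,P)} → P ↪ S_v)`.
[cite: MochizukiSemiAnbd2006, Def. 2.2(i) p.23] -/
noncomputable def reassembledHom : A.reassembled D ⟶ A where
  fS v := Sigma.desc (fun c => A.famVHom D v c ≫ (A.vComp ⟨v, c⟩).1.arrow)
  fT e := Sigma.desc (fun c' => (A.pieceE D e c').hom ≫ (A.eComp ⟨e, c'⟩).1.arrow)
  comm b v h := by
    rw [reassembled_ψ]
    obtain ⟨hc⟩ := A.isColimit_cofan_glueV D h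
    refine Cofan.IsColimit.hom_ext hc _ _ (fun c' => ?_)
    rw [cofan_mk_inj]
    have hR := A.ι_glueψ_hom D h c'
    simp only [Category.assoc]
    rw [reassoc_of% hR, Sigma.ι_desc, ← Functor.map_comp_assoc, Sigma.ι_desc, Functor.map_comp_assoc]
    have hcond := pullback.condition
      (f := ((Over.post (𝒢.pull b v h).pullback).obj (Over.mk (A.famVHom D v (A.fibreData.σ b v h c')))).hom)
      (g := A.inclOfLE h (A.vComp ⟨v, A.fibreData.σ b v h c'⟩).1 (A.brComp ⟨b, c'⟩).1
        (brComp_le_branchImage (A.total_abuts_mk h c')))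
    erw [reassoc_of% hcond, A.inclOfLE_comp h]
    have hw := Over.w (A.pieceGlueIso D h c').inv
    rw [← hw, Category.assoc]
    rfl

/-- **The reassembled object over `A`.** [cite: MochizukiSemiAnbd2006, Def. 2.2(i) p.23] -/
noncomputable def reassembledOver : Over A := Over.mk (A.reassembledHom D)

end BObj

end SemiGraphOfAnabelioids

end Literature.AnabelianGeometry.SemiGraphs
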